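import Literature.Geometry.Lorentzian.Causality
import HarnessLib

/-!
# Globally hyperbolic spacetimes are strongly causal (Bernal–Sánchez 2007, Thm. 3.2)

The faithful, Hausdorff form of the theorem whose hypothesis-free vendoring
`LorentzianMetric.IsGloballyHyperbolic.isStronglyCausal` was refuted on the line with two origins
(`Literature.Geometry.Lorentzian.TwoOriginLine`) and deprecated into
`Literature.Geometry.Lorentzian.CausalityRefutedFacts`. That module's docstring records the printed
theorem and the faithful binder form — "`∀ [T2Space M] [SecondCountableTopology M]
[BoundarylessManifold I M] [FiniteDimensional ℝ E] (_ : 2 ≤ n) (_ : g.IsGloballyHyperbolic τ),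
g.IsStronglyCausal τ` — … not vendored (no in-tree user, 2026-08-15)". There are users now: the
FinalStateConjecture routes ZeroEnergyKerrOrBomb / SignedCensus / BeltLiouville argue
"globally hyperbolic ⇒ strongly causal ⇒ no causal ray imprisoned in a compact set" (refuter
repairs of `ZeroEnergyRigidity`, 2026-08-15), which needs this fact together with
`LorentzianMetric.IsStronglyCausal.exists_forall_notMem_of_isCompact`
(`Literature.Geometry.Lorentzian.NonImprisonment`). Vendored here as a NAMED FACT (D-0014), under
a NEW name (the deprecated constant keeps the old one).

Source (read 2026-08-15 from arXiv:gr-qc/0611138 = Class. Quantum Grav. 24 (2007) 745–749,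
p. 3): "Theorem 3.2. Assume that `(M, g)` satisfies: (A) `J⁺(p) ∩ J⁻(q)` is compact for all
`p, q ∈ M`. Then the following two conditions are equivalent: (B1) `(M, g)` is causal, i.e.,
there are no closed causal curves. (B2) `(M, g)` is strongly causal, i.e., for any `p ∈ M`, given
any neighborhood `U` of `p` there exists a neighborhood `V ⊆ U`, `p ∈ V`, such that any
future-directed (and hence also any past-directed) causal curve `γ : [a, b] → M` with endpoints at
`V` is entirely contained in `U`." For Bernal–Sánchez a spacetime is a connected, Hausdorff,
time-oriented smooth Lorentzian manifold ("All the notation and concepts are standard", p. 2,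
refs. [1, 5, 7, 8, 10, 11] = Beem–Ehrlich–Easley, Hawking–Ellis, O'Neill, Penrose, …).
[BernalSanchez2007CQG]

## Design

* `IsGloballyHyperbolic g τ` of `….Causality` IS the Bernal–Sánchez form (causal + compact causal
  diamonds), so the fact is literally (A) ∧ (B1) ⇒ (B2); `IsStronglyCausal` of `….Causality` is
  (B2) verbatim (future causal curve segments on `Icc a b` with endpoints in `V` stay in `U`).
* Standing hypotheses written INTO the `Prop`, exactly the binder list pre-announced in
  `….CausalityRefutedFacts` plus `ConnectedSpace M` (print's "spacetime"): Hausdorff (the refuted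
  omission), second countable, no boundary, finite-dimensional model, `C²` metric (`2 ≤ n`; the
  printed proof runs through causal simplicity, causal continuity and time functions,
  Remark 3.3).

## What is NOT here

No proof (literature-prover: Lemma 3.1 closedness of `J±(p)` from compact diamonds — cf. the
proved `IsGloballyHyperbolic.isClosed_causalFuture_singleton` in `….CausalityProofs` — then causal
simplicity ⇒ strong causality along the causal ladder), and not the converse (B2) ⇒ (B1), which
is the in-tree `IsStronglyCausal.isCausallyWellBehaved`.
-/

open Set Filter
open scoped Manifold ContDiff Topology

namespace Literature.Geometry.Lorentzian

variable {E : Type*} [NormedAddCommGroup E] [NormedSpace ℝ E] {H : Type*} [TopologicalSpace H]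
  {I : ModelWithCorners ℝ E H} {n : ℕ∞ω} {M : Type*} [TopologicalSpace M] [ChartedSpace H M]
  [IsManifold I ∞ M]

namespace LorentzianMetric

variable (g : LorentzianMetric I n M) (τ : TimeOrientation g)

/-- **Bernal–Sánchez 2007, Thm. 3.2 ((A) ∧ (B1) ⇒ (B2)), faithful Hausdorff form.** On a
connected, Hausdorff, second countable, finite-dimensional manifold without boundary with a `C²`
time-oriented Lorentzian metric: if `(M, g, τ)` is globally hyperbolic in the Bernal–Sánchez sense
(`IsGloballyHyperbolic`: no closed causal curves and every causal diamond `J⁺(p) ∩ J⁻(q)` compact)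
then it is strongly causal (`IsStronglyCausal`). "Assume that `(M, g)` satisfies: (A) `J⁺(p) ∩
J⁻(q)` is compact for all `p, q ∈ M`. Then the following two conditions are equivalent: (B1)
`(M, g)` is causal … (B2) `(M, g)` is strongly causal" (loc. cit., p. 3). Replaces, under a new
name and with the hypotheses the refutation `TwoOriginLine.not_isGloballyHyperbolic_isStronglyCausal`
showed to be necessary, the deprecated `IsGloballyHyperbolic.isStronglyCausal` of
`….CausalityRefutedFacts`. Named fact (D-0014).
[cite: BernalSanchez2007CQG, Thm. 3.2 (p. 747; arXiv gr-qc/0611138 p. 3)] -/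
def bernalSanchez_isStronglyCausal_of_isGloballyHyperbolic : Prop :=
  ∀ [T2Space M] [SecondCountableTopology M] [ConnectedSpace M] [BoundarylessManifold I M]
    [FiniteDimensional ℝ E] (_ : 2 ≤ n) (_ : g.IsGloballyHyperbolic τ), g.IsStronglyCausal τ

/-- Unfolding lemma (statement shape check). [folklore] -/
lemma bernalSanchez_isStronglyCausal_of_isGloballyHyperbolic_iff :
    bernalSanchez_isStronglyCausal_of_isGloballyHyperbolic g τ ↔
      ∀ [T2Space M] [SecondCountableTopology M] [ConnectedSpace M] [BoundarylessManifold I M]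
        [FiniteDimensional ℝ E] (_ : 2 ≤ n) (_ : g.IsGloballyHyperbolic τ),
        g.IsStronglyCausal τ :=
  Iff.rfl

end LorentzianMetric

end Literature.Geometry.Lorentzian
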